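import Literature.IUT.HodgeTheaters.Cor53iLiftsAllAtArithmeticRecords
import Literature.AlgebraicGeometry.Frobenioids.CategoriesFiberProductTwist
import HarnessLib

/-!
# [IUTchI] Cor 5.3 (i) «respectively, `⊚`»: the surjectivity half at `†ℱ^⊚ → †𝒟^⊚` — every self-equivalence of
# `†𝒟^⊚` that DESCENDS to `Base(†ℱ^⊛)` lifts to `†ℱ^⊚ = †ℱ^⊛ ×_{Base(†ℱ^⊛)} †𝒟^⊚`, modulo Neukirch–Uchida BY NAME

S. Mochizuki, *Inter-universal Teichmüller theory I*, kurims manuscript (May 2020), §5 Corollary 5.3 (i) p. 144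
l. 2–11 («the natural map `Isom(¹ℱ^⊛, ²ℱ^⊛) → Isom(Base(¹ℱ^⊛), Base(²ℱ^⊛))` (respectively,
`Isom(¹ℱ^⊚, ²ℱ^⊚) → Isom(Base(¹ℱ^⊚), Base(²ℱ^⊚))`) … is bijective»); Example 5.1 (iii) pp. 125–126
(`†ℱ^⊚ := †ℱ^⊛|_{†𝒟^⊚}`, "the restriction of `†ℱ^⊛` to `†𝒟^⊚` via the natural morphism `†𝒟^⊚ → †𝒟^⊛`")
([IUTchI] Cor 5.3 (i) p.144) [claim: Mochizuki2012, status: disputed] (D-0012 claim key; PROOFS ONLY over landed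
files; nothing of the series is asserted; no side is taken on [IUTchIII] Cor. 3.12); [FrdI] §0 p. 17 (categorical
fibre products) [cite: MochizukiFrdI2008, §0 p.17].

PROOF-ONLY (cell abc-iut, L5 hub node `IUTchI:Cor5.3(i)`, seat abc-iut-w4-d109 gen 9, row C53ILIFT — the `⊚` TWIN
asked for by abc-iut-L5-lead RULINGS #153 (2)(c)).  abc-iut-w4-d050 typed `†ℱ^⊚` as the categorical fibre product
`𝓕.Fcirc = CFP 𝓕.toBase 𝓕.baseMor` with base functor `fcircBase = proj₂ : †ℱ^⊚ → †𝒟^⊚` (`GlobalFrobenioidsModel`);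
abc-iut-L5-t4's (k2) knit (`Cor53.fcirc_descendBijective_of_kernel_trivial_of_lifts`, p517769) displays the binder
`hlift⊚ : ∀ Θ : †𝒟^⊚ ⥲ †𝒟^⊚, ∃ Ψ : †ℱ^⊚ ⥲ †ℱ^⊚ over Θ`.  A self-equivalence of the fibre product over `Θ` needs
`Θ` to DESCEND to `Base(†ℱ^⊛)` along `†𝒟^⊚ → Base(†ℱ^⊛)` — at the abstraction of abc-iut-L5-t1's record (`Dcirc`,
`toBase0`, `baseMor` are PARAMETERS) nothing forces this, so it is displayed as the ONE law binder

  `hdesc⊚ : ∀ Θ : Dcirc ≌ Dcirc, ∃ Θ_B : 𝓕.Base ≌ 𝓕.Base, Nonempty (Θ ⋙ 𝓕.baseMor ≅ 𝓕.baseMor ⋙ Θ_B)`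

(print's content: self-equivalences of `†𝒟^⊚ = ℬ(Π_{C_K})⁰` come from automorphisms of `C_K` — [AbsTopIII] Thm 1.9,
FACT-LIST F-0399 class — which act on `C_F`, an `F`-core, hence on `†𝒟^⊛`; Ex. 5.1 (i)/(iii)).  Given `hdesc⊚`,
the descended `Θ_B` lifts to `†ℱ^⊛` by abc-iut-w4-d109's record-level lift (`GlobalFrobenioid.liftsAll_toBase_arith_of_neukirchUchida`,
modulo `NeukirchUchida F`), and the compatible triple `(Ψ₁, Θ, Θ_B)` acts on the fibre product over `Θ` on the nose
(abc-iut-w4-d109 `CFP.exists_equivalence_of_compatible_triple`, [FrdI] §0):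

* **`GlobalFrobenioid.liftsAll_fcircBase_arith_of_desc_of_neukirchUchida 𝓕 (hdesc) (hNU)`** = the binder `hlift⊚` of
  p517769 (k2) VERBATIM (any `Dcirc`), ⟸ LAW {hdesc⊚} · FACT {`NeukirchUchida F`};
* one-calls at `Dcirc = ℬ(H)⁰`, `H` slim (the (k2) setting): `Cor53.fcirc_descend_surjective_of_desc_of_neukirchUchida`
  and `Cor53.fcirc_descendBijective_of_kernel_trivial_of_desc_of_neukirchUchida (hker) (hdesc) (hNU)`.

Census of the `⊚` headline after this file: LAW {hdesc⊚ (F-0399-shaped descent), hker⊚ (Ex 5.1 (v), for bijectivity)}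
· FACT {`NeukirchUchida F`} · side {`IsSlimGroup H`} · DATA {F, 𝓕}.  0 `def`, no instance, no notation, no new `Prop`;
binders are displayed, not asserted; nothing here asserts abc proved or refuted.
-/

noncomputable section

namespace Literature.IUT.HodgeTheaters

open CategoryTheory Literature.AlgebraicGeometry.Frobenioids Literature.NumberTheory.GaloisRepresentations

/-! ### `hlift⊚` from descent + Neukirch–Uchida -/

namespace GlobalFrobenioid

variable {F : Type} [Field F] [NumberField F] {Dcirc : Type 1} [Category.{0} Dcirc]
  {toBase0 : Dcirc ⥤ BaseCat (absGalGrp F)} (𝓕 : GlobalFrobenioid (GlobalDivisorData.arith F) Dcirc toBase0)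

/-- **One self-equivalence of `†𝒟^⊚` that descends, lifts**: for `Θ : †𝒟^⊚ ⥲ †𝒟^⊚` descending to `Θ_B` on `Base(†ℱ^⊛)`
along `†𝒟^⊚ → Base(†ℱ^⊛)` (`σ : Θ ⋙ baseMor ≅ baseMor ⋙ Θ_B`), there is a self-equivalence of
`†ℱ^⊚ = †ℱ^⊛ ×_{Base(†ℱ^⊛)} †𝒟^⊚` lying over `Θ` — lift `Θ_B` to `†ℱ^⊛` (record-level lift, Neukirch–Uchida BY NAME)
and let the compatible triple act on the fibre product (`CFP.exists_equivalence_of_compatible_triple`).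
([IUTchI] Cor 5.3 (i) p.144) [claim: Mochizuki2012, status: disputed] -/
theorem exists_fcirc_equivalence_liesUnder_of_descends (hNU : NeukirchUchida F) (Θ : Dcirc ≌ Dcirc)
    (ΘB : 𝓕.Base ≌ 𝓕.Base) (σ : Θ.functor ⋙ 𝓕.baseMor ≅ 𝓕.baseMor ⋙ ΘB.functor) :
    ∃ Ψ : 𝓕.Fcirc ≌ 𝓕.Fcirc, Nonempty (CatIsomorphism.LiesUnder 𝓕.fcircBase 𝓕.fcircBase Ψ Θ) := by
  obtain ⟨Ψ₁, ⟨σ₁⟩⟩ := 𝓕.liftsAll_toBase_arith_of_neukirchUchida hNU ΘB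
  obtain ⟨e, -, he⟩ := CFP.exists_equivalence_of_compatible_triple 𝓕.toBase 𝓕.baseMor Ψ₁ Θ ΘB σ₁ σ
  exact ⟨e, ⟨eqToIso he⟩⟩

/-- **[IUTchI] Cor 5.3 (i) «respectively `⊚`», SURJECTIVITY half at `†ℱ^⊚ → †𝒟^⊚`** for every isomorph record of the
genuine arithmetic model: if every self-equivalence `Θ` of `†𝒟^⊚` descends to `Base(†ℱ^⊛)` along `†𝒟^⊚ → Base(†ℱ^⊛)`
(binder `hdesc`, displayed), then every `Θ` lifts to a self-equivalence of `†ℱ^⊚ = †ℱ^⊛ ×_{Base(†ℱ^⊛)} †𝒟^⊚` lying over it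
(`Ψ ⋙ fcircBase ≅ fcircBase ⋙ Θ`), modulo Neukirch–Uchida BY NAME. This is the binder `hlift` of
`Cor53.fcirc_descendBijective_of_kernel_trivial_of_lifts` (p517769 (k2)), verbatim.
([IUTchI] Cor 5.3 (i) p.144) [claim: Mochizuki2012, status: disputed] -/
theorem liftsAll_fcircBase_arith_of_desc_of_neukirchUchida
    (hdesc : ∀ Θ : Dcirc ≌ Dcirc, ∃ ΘB : 𝓕.Base ≌ 𝓕.Base,
      Nonempty (Θ.functor ⋙ 𝓕.baseMor ≅ 𝓕.baseMor ⋙ ΘB.functor))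
    (hNU : NeukirchUchida F) :
    ∀ Θ : Dcirc ≌ Dcirc, ∃ Ψ : 𝓕.Fcirc ≌ 𝓕.Fcirc,
      Nonempty (CatIsomorphism.LiesUnder 𝓕.fcircBase 𝓕.fcircBase Ψ Θ) := by
  intro Θ
  obtain ⟨ΘB, ⟨σ₂⟩⟩ := hdesc Θ
  exact 𝓕.exists_fcirc_equivalence_liesUnder_of_descends hNU Θ ΘB σ₂

/-- The same in abc-iut-w4-d047's `HasLift` currency. ([IUTchI] Cor 5.3 (i) p.144) [claim: Mochizuki2012, status: disputed] -/
theorem hasLift_fcircBase_arith_of_desc_of_neukirchUchida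
    (hdesc : ∀ Θ : Dcirc ≌ Dcirc, ∃ ΘB : 𝓕.Base ≌ 𝓕.Base,
      Nonempty (Θ.functor ⋙ 𝓕.baseMor ≅ 𝓕.baseMor ⋙ ΘB.functor))
    (hNU : NeukirchUchida F) :
    CatIsomorphism.HasLift 𝓕.fcircBase 𝓕.fcircBase :=
  𝓕.liftsAll_fcircBase_arith_of_desc_of_neukirchUchida hdesc hNU

end GlobalFrobenioid

/-! ### One-calls over the (k2) knit at `†𝒟^⊚ = ℬ(H)⁰`, `H` slim -/

namespace Cor53

variable {F : Type} [Field F] [NumberField F] {H : ProfiniteGrp.{0}} {toBase0 : BaseCat H ⥤ BaseCat (absGalGrp F)}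
  (𝓕 : GlobalFrobenioid (GlobalDivisorData.arith F) (BaseCat H) toBase0) (hZ : IsSlimGroup H)

/-- **The §0 natural map `Aut(†ℱ^⊚) → Aut(†𝒟^⊚)` is SURJECTIVE** (`†𝒟^⊚ = ℬ(H)⁰`, `H` slim; binders `he`/`hu` at `fcircBase`
discharged by abc-iut-w4-d109 gen 8, p498351): LAW {hdesc⊚} · FACT {`NeukirchUchida F`}.
([IUTchI] Cor 5.3 (i) p.144) [claim: Mochizuki2012, status: disputed] -/
theorem fcirc_descend_surjective_of_desc_of_neukirchUchida
    (hdesc : ∀ Θ : BaseCat H ≌ BaseCat H, ∃ ΘB : 𝓕.Base ≌ 𝓕.Base,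
      Nonempty (Θ.functor ⋙ 𝓕.baseMor ≅ 𝓕.baseMor ⋙ ΘB.functor))
    (hNU : NeukirchUchida F) :
    Function.Surjective (CatIsomorphism.descend
      (GlobalFrobenioid.hasUnder_and_underUnique_fcircBase_arith_baseCat 𝓕 𝓕 hZ hZ).1
      (GlobalFrobenioid.hasUnder_and_underUnique_fcircBase_arith_baseCat 𝓕 𝓕 hZ hZ).2) :=
  CatIsomorphism.descend_surjective_of_lifts _ _ (𝓕.liftsAll_fcircBase_arith_of_desc_of_neukirchUchida hdesc hNU)

/-- **[IUTchI] Cor 5.3 (i) «respectively `⊚`» AS PRINTED («bijective») at `†ℱ^⊚ → †𝒟^⊚ = ℬ(H)⁰`, `H` slim**, census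
after this file: LAW {hker⊚ (kernel triviality, Ex 5.1 (v)), hdesc⊚ (descent of `Aut(†𝒟^⊚)` to `Base(†ℱ^⊛)`)} · FACT
{`NeukirchUchida F`} — abc-iut-L5-t4's (k2) one-liner with its `hlift` DISCHARGED modulo these.
([IUTchI] Cor 5.3 (i) p.144) [claim: Mochizuki2012, status: disputed] -/
theorem fcirc_descendBijective_of_kernel_trivial_of_desc_of_neukirchUchida
    (hker : ∀ Ψ : 𝓕.Fcirc ≌ 𝓕.Fcirc,
      Nonempty (CatIsomorphism.LiesUnder 𝓕.fcircBase 𝓕.fcircBase Ψ (CategoryTheory.Equivalence.refl (C := BaseCat H))) →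
      Nonempty (Ψ.functor ≅ 𝟭 𝓕.Fcirc))
    (hdesc : ∀ Θ : BaseCat H ≌ BaseCat H, ∃ ΘB : 𝓕.Base ≌ 𝓕.Base,
      Nonempty (Θ.functor ⋙ 𝓕.baseMor ≅ 𝓕.baseMor ⋙ ΘB.functor))
    (hNU : NeukirchUchida F) :
    CatIsomorphism.DescendBijective 𝓕.fcircBase 𝓕.fcircBase
      (GlobalFrobenioid.hasUnder_and_underUnique_fcircBase_arith_baseCat 𝓕 𝓕 hZ hZ).1
      (GlobalFrobenioid.hasUnder_and_underUnique_fcircBase_arith_baseCat 𝓕 𝓕 hZ hZ).2 :=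
  fcirc_descendBijective_of_kernel_trivial_of_lifts 𝓕 hZ hker
    (𝓕.liftsAll_fcircBase_arith_of_desc_of_neukirchUchida hdesc hNU)

end Cor53

end Literature.IUT.HodgeTheaters

end
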